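import Summits.AnomalousDissipation.AnomalousDissipation.Theses.MomentParity
import Summits.AnomalousDissipation.AnomalousDissipation.Theorems.QuarticGate.Negative.EnergyRow
import Summits.AnomalousDissipation.AnomalousDissipation.Theorems.ResolvedDissipation.Negative.KillShape
import Summits.AnomalousDissipation.AnomalousDissipation.Theorems.MomentParityResolvedDissipationStubStressEnergyEq
import Literature.Analysis.FluidPDE.StatisticalSolutionEnergyEq
import Literature.Analysis.FluidPDE.StatisticalSolutionProofs
import Literature.Analysis.FluidPDE.CylindricalGenerator

/-!
# `MomentParity.ResolvedDissipation` (stmt-AnomalousDissipation-14284), line `lions-l4-domination` (v4):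
# the Reynolds-stress second moment (K1) dominates the mean maximal energy flux (K1′)

Supports stmt-AnomalousDissipation-14284 (helper of the line lead; nothing here closes an item).

`uniformMaximalFlux_of_uniformStressMoment` certifies that the v3 reshape of the planner's hard stub
K1 (an `N`-uniform bound `∫ ‖B(u,u)‖²_{V′} dμ ≤ C` on the second moment of the Reynolds-stress dual norm
`‖B(u,u)‖_{V′} = D(u) = sup {|∫ (u ⊗ u) : ∇w| : w smooth, div-free, mean-zero, ‖∇w‖₂² ≤ 1}` over the
admissible laws at `(f, ν, R)`) into K1′ (an `N`-uniform bound on the FIRST moment of the maximal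
Galerkin energy flux `Π*(u) = sup_m |Π_m(u)|`, `Π_m(u) = ∫ (u ⊗ u) : ∇P_m u`) is a WEAKENING: at fixed
`(f, ν, R)`, K1 with constant `C` implies K1′ with constant `C' = C + ‖f‖₂ R / ν + 1`.

Proof. POINTWISE on `H`, `Π*(u) ≤ D(u)² + ‖∇u‖₂² + 1` (`iSup_enorm_flux_le`): each truncation `P_m u`,
normalised by `(‖∇P_m u‖₂² + 1)^{-1/2}`, is admissible in the supremum defining `D(u)`, so
`|Π_m(u)| ≤ D(u) (‖∇P_m u‖₂² + 1)^{1/2}` (the landed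
`StressEnergyEq.abs_inertialPairing_fourierTruncate_le_stress`), then `ab ≤ a² + b²` and
`‖∇P_m u‖₂² ≤ ‖∇u‖₂²` (`Torus.eGradNormSq_fourierTruncate_le`). INTEGRATE: `∫⁻ Π* dμ ≤ ∫⁻ D² dμ +
∫⁻ ‖∇u‖² dμ + 1 ≤ C + ‖f‖₂ R / ν + 1` by the hypothesis and the `N`-uniform enstrophy budget of admissible
laws (`ResolvedDissipation.Negative.ensembleEnstrophy_le_of_isStationary`, energy row + Cauchy–Schwarz);
`D²` is measurable as the square of a lower semicontinuous function (`Torus.continuous_inertialPairing_coe`)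
and `‖∇u‖²` by `Torus.measurable_eGradNormSq_coe`.
-/

noncomputable section

-- `Summit.<Summit>.<Problem>`: single-conjunct summit, the duplicate namespace segment is mandated.
set_option linter.dupNamespace false

namespace Summit.AnomalousDissipation.AnomalousDissipation.Theorems.MomentParityResolvedDissipation.MaxFluxOfStress

open MeasureTheory Filter Topology
open scoped ENNReal NNReal InnerProductSpace RealInnerProductSpace
open Literature.Analysis.FunctionSpaces Literature.Analysis.FluidPDE
open Summit.AnomalousDissipation.AnomalousDissipation.Theses.MomentParity
open Summit.AnomalousDissipation.AnomalousDissipation.Theorems.QuarticGate.Negative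

/-! ## The pointwise domination `Π*(u) ≤ D(u)² + ‖∇u‖² + 1` -/

/-- **The maximal Galerkin flux is dominated by the squared Reynolds-stress dual norm plus the
enstrophy**: for every `u ∈ H = L²_σ(T³)`,
`sup_m |∫ (u ⊗ u) : ∇P_m u| ≤ D(u)² + ‖∇u‖₂² + 1` in `[0, ∞]`, where
`D(u) = sup {|∫ (u ⊗ u) : ∇w| : w smooth, div-free, mean-zero, ‖∇w‖₂² ≤ 1}`
(`|Π_m(u)| ≤ D(u) (‖∇P_m u‖₂² + 1)^{1/2}` by admissibility of the normalised truncation, `ab ≤ a² + b²`,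
`‖∇P_m u‖₂² ≤ ‖∇u‖₂²`; trivial if `D(u) = ∞`). [folklore] -/
theorem iSup_enorm_flux_le (u : Torus.energySpace (Fin 3)) :
    (⨆ m : ℕ, ‖Torus.inertialPairing u.1 (Torus.fourierTruncate m
        (u.1 : UnitAddTorus (Fin 3) → EuclideanSpace ℝ (Fin 3)))‖ₑ) ≤
      (⨆ (w : UnitAddTorus (Fin 3) → EuclideanSpace ℝ (Fin 3))
          (_ : Torus.IsSmooth w ∧ Torus.IsDivFree w ∧ Torus.HasZeroMean w ∧ Torus.eGradNormSq w ≤ 1),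
          ‖Torus.inertialPairing u.1 w‖ₑ) ^ 2 +
        Torus.eGradNormSq (u.1 : UnitAddTorus (Fin 3) → EuclideanSpace ℝ (Fin 3)) + 1 := by
  set D : ℝ≥0∞ := ⨆ (w : UnitAddTorus (Fin 3) → EuclideanSpace ℝ (Fin 3))
      (_ : Torus.IsSmooth w ∧ Torus.IsDivFree w ∧ Torus.HasZeroMean w ∧ Torus.eGradNormSq w ≤ 1),
      ‖Torus.inertialPairing u.1 w‖ₑ with hD
  by_cases hDtop : D = ⊤
  · rw [hDtop, ENNReal.top_pow two_ne_zero, top_add, top_add]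
    exact le_top
  refine iSup_le fun m => ?_
  have hint : Integrable (u.1 : UnitAddTorus (Fin 3) → EuclideanSpace ℝ (Fin 3)) volume :=
    (Lp.memLp _).integrable one_le_two
  set Zm : ℝ≥0∞ := Torus.eGradNormSq (Torus.fourierTruncate m
    (u.1 : UnitAddTorus (Fin 3) → EuclideanSpace ℝ (Fin 3))) with hZm
  have hZm_le : Zm ≤ Torus.eGradNormSq (u.1 : UnitAddTorus (Fin 3) → EuclideanSpace ℝ (Fin 3)) :=
    Torus.eGradNormSq_fourierTruncate_le hint m
  have hZm_fin : Zm ≠ ⊤ := (Torus.eGradNormSq_lt_top (Torus.isSmooth_fourierTruncate m _)).ne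
  have hZ0 : 0 ≤ Zm.toReal := ENNReal.toReal_nonneg
  have hD0 : 0 ≤ D.toReal := ENNReal.toReal_nonneg
  -- the real-valued domination of the landed P1 file
  have h3 : |Torus.inertialPairing u.1 (Torus.fourierTruncate m
      (u.1 : UnitAddTorus (Fin 3) → EuclideanSpace ℝ (Fin 3)))| ≤
      D.toReal * Real.sqrt (Zm.toReal + 1) :=
    StressEnergyEq.abs_inertialPairing_fourierTruncate_le_stress u m hDtop
  have hsq : Real.sqrt (Zm.toReal + 1) ^ 2 = Zm.toReal + 1 := Real.sq_sqrt (by linarith)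
  have hreal : |Torus.inertialPairing u.1 (Torus.fourierTruncate m
      (u.1 : UnitAddTorus (Fin 3) → EuclideanSpace ℝ (Fin 3)))| ≤
      D.toReal ^ 2 + (Zm.toReal + 1) := by
    refine h3.trans ?_
    nlinarith [two_mul_le_add_sq D.toReal (Real.sqrt (Zm.toReal + 1)),
      mul_nonneg hD0 (Real.sqrt_nonneg (Zm.toReal + 1))]
  rw [Real.enorm_eq_ofReal_abs]
  calc ENNReal.ofReal |Torus.inertialPairing u.1 (Torus.fourierTruncate m
        (u.1 : UnitAddTorus (Fin 3) → EuclideanSpace ℝ (Fin 3)))|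
      ≤ ENNReal.ofReal (D.toReal ^ 2 + (Zm.toReal + 1)) := ENNReal.ofReal_le_ofReal hreal
    _ = D ^ 2 + Zm + 1 := by
        rw [ENNReal.ofReal_add (by positivity) (by positivity), ENNReal.ofReal_add hZ0 zero_le_one,
          ENNReal.ofReal_pow hD0, ENNReal.ofReal_toReal hDtop, ENNReal.ofReal_toReal hZm_fin,
          ENNReal.ofReal_one, add_assoc]
    _ ≤ D ^ 2 + Torus.eGradNormSq (u.1 : UnitAddTorus (Fin 3) → EuclideanSpace ℝ (Fin 3)) + 1 := by
        gcongr

/-! ## K1 ⇒ K1′ -/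

/-- **K1 ⇒ K1′: an `N`-uniform Reynolds-stress second moment implies an `N`-uniform mean maximal
flux.** Fix `f ∈ L²`, `ν > 0`, `R` and `C`. If every admissible law `μ` (probability on `H`, carried by
level-`N` fields, supported in `‖u‖ ≤ R`, stationary for Galerkin NS at `(ν, f)` against all polynomial
cylindrical band-limited observables), at every level `N`, has `∫ D(u)² dμ ≤ C` for the Reynolds-stress
dual norm `D(u) = sup {|∫ (u ⊗ u) : ∇w| : w smooth, div-free, mean-zero, ‖∇w‖₂² ≤ 1}`, then every such
law has mean maximal Galerkin flux `∫ sup_m |∫ (u ⊗ u) : ∇P_m u| dμ ≤ C'` with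
`C' = C + ‖f‖₂ R / ν + 1`: integrate the pointwise domination `Π*(u) ≤ D(u)² + ‖∇u‖² + 1`
(`iSup_enorm_flux_le`) and use the `N`-uniform enstrophy budget `∫ ‖∇u‖² dμ ≤ ‖f‖₂ R / ν` of
admissible laws (energy row + Cauchy–Schwarz). So the v3 hard stub K1′ is implied by the planner's K1.
[folklore] -/
theorem uniformMaximalFlux_of_uniformStressMoment :
    ∀ (f : UnitAddTorus (Fin 3) → EuclideanSpace ℝ (Fin 3)) (ν R : ℝ) (C : ℝ≥0), 0 < ν → MemLp f 2 volume →
    (∀ (N : ℕ) (μ : Measure (Torus.energySpace (Fin 3))), IsProbabilityMeasure μ →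
      (∀ᵐ u ∂μ, IsLevel N u) → (∀ᵐ u ∂μ, ‖u‖ ≤ R) → (∀ d : ℕ, IsPolyStationary ν f N d μ) →
      ∫⁻ u, (⨆ (w : UnitAddTorus (Fin 3) → EuclideanSpace ℝ (Fin 3))
          (_ : Torus.IsSmooth w ∧ Torus.IsDivFree w ∧ Torus.HasZeroMean w ∧ Torus.eGradNormSq w ≤ 1),
          ‖Torus.inertialPairing u.1 w‖ₑ) ^ 2 ∂μ ≤ C) →
    ∃ C' : ℝ≥0, ∀ (N : ℕ) (μ : Measure (Torus.energySpace (Fin 3))), IsProbabilityMeasure μ →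
      (∀ᵐ u ∂μ, IsLevel N u) → (∀ᵐ u ∂μ, ‖u‖ ≤ R) → (∀ d : ℕ, IsPolyStationary ν f N d μ) →
      ∫⁻ u, (⨆ m : ℕ, ‖Torus.inertialPairing u.1 (Torus.fourierTruncate m
          (u.1 : UnitAddTorus (Fin 3) → EuclideanSpace ℝ (Fin 3)))‖ₑ) ∂μ ≤ C' := by
  intro f ν R C hν hf hC
  refine ⟨C + (Real.sqrt (∫ x, ‖f x‖ ^ 2) * R / ν).toNNReal + 1, fun N μ hp hlev hR hs => ?_⟩
  -- an admissible probability law in the ball forces `0 ≤ R`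
  haveI : (ae μ).NeBot := ae_neBot.2 (IsProbabilityMeasure.ne_zero μ)
  obtain ⟨u₀, hu₀⟩ := hR.exists
  have hR0 : 0 ≤ R := (norm_nonneg _).trans hu₀
  -- the `N`-uniform enstrophy budget
  have hstat : ResolvedDissipation.Negative.IsStationary ν f N μ := fun m g P hg =>
    hs (P.totalDegree + 1) m g P hg le_rfl
  have hbudget : Torus.ensembleEnstrophy μ ≤ ENNReal.ofReal (Real.sqrt (∫ x, ‖f x‖ ^ 2) * R / ν) :=
    ResolvedDissipation.Negative.ensembleEnstrophy_le_of_isStationary hν hf hlev hR0 hR hstat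
  -- measurability of the two dominating functionals
  set D : Torus.energySpace (Fin 3) → ℝ≥0∞ := fun u => ⨆ (w : UnitAddTorus (Fin 3) → EuclideanSpace ℝ (Fin 3))
      (_ : Torus.IsSmooth w ∧ Torus.IsDivFree w ∧ Torus.HasZeroMean w ∧ Torus.eGradNormSq w ≤ 1),
      ‖Torus.inertialPairing u.1 w‖ₑ with hD
  have hDlsc : LowerSemicontinuous D :=
    lowerSemicontinuous_biSup fun w hw =>
      ((Torus.continuous_inertialPairing_coe hw.1).enorm).lowerSemicontinuous
  have hD2 : Measurable fun u => D u ^ 2 := hDlsc.measurable.pow_const 2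
  have hZ : Measurable fun u : Torus.energySpace (Fin 3) =>
      Torus.eGradNormSq (u.1 : UnitAddTorus (Fin 3) → EuclideanSpace ℝ (Fin 3)) :=
    Torus.measurable_eGradNormSq_coe
  have hCD : ∫⁻ u, D u ^ 2 ∂μ ≤ C := hC N μ hp hlev hR hs
  calc ∫⁻ u, (⨆ m : ℕ, ‖Torus.inertialPairing u.1 (Torus.fourierTruncate m
          (u.1 : UnitAddTorus (Fin 3) → EuclideanSpace ℝ (Fin 3)))‖ₑ) ∂μ
      ≤ ∫⁻ u, D u ^ 2 +
          Torus.eGradNormSq (u.1 : UnitAddTorus (Fin 3) → EuclideanSpace ℝ (Fin 3)) + 1 ∂μ :=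
        lintegral_mono fun u => iSup_enorm_flux_le u
    _ = (∫⁻ u, D u ^ 2 ∂μ) + Torus.ensembleEnstrophy μ + 1 := by
        rw [lintegral_add_right _ measurable_const, lintegral_add_left hD2, lintegral_const,
          measure_univ, mul_one, Torus.ensembleEnstrophy]
    _ ≤ (C : ℝ≥0∞) + ENNReal.ofReal (Real.sqrt (∫ x, ‖f x‖ ^ 2) * R / ν) + 1 := by
        gcongr
    _ = ((C + (Real.sqrt (∫ x, ‖f x‖ ^ 2) * R / ν).toNNReal + 1 : ℝ≥0) : ℝ≥0∞) := by
        rw [ENNReal.coe_add, ENNReal.coe_add, ENNReal.coe_one, ENNReal.ofReal]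

end Summit.AnomalousDissipation.AnomalousDissipation.Theorems.MomentParityResolvedDissipation.MaxFluxOfStress

end
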